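import Mathlib
import Summits.NavierStokesRegularity.NavierStokesRegularity.Theorems.EulerZoomLiouvillePowerGaugeEulerLiouvilleSelfSimilarBernoulliSqueezeSobolev
import HarnessLib

/-!
# «SUPER-FAST CHANNELS SQUEEZE VOLUME TOO FAST», past half: tools for the SOBOLEV THINNESS OF THE HIGH BERNOULLI SETS FROM GROWTH-FORM DATA
# (crux `EulerZoomLiouville.PowerGaugeEulerLiouville` = stmt-NavierStokesRegularity-19832, line `birth`, THE ONE STATEMENT `stub_selfSimilarC2Needle`
#  and its past stratum `IsPastSelfSimilarClassical`)

Route №10 `EulerZoomLiouville` (NavierStokesRegularity); width seat ns-ezl-w5 g2.  The seat's g0 (C2) squeeze chain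
`…SelfSimilarBernoulliSqueeze{,Member,Sharp,Vortical,VorticalMember,Past,SharpPast}` + the LEAD's Sobolev thinness (`…SqueezeSobolev{,Member}`, p636011 /
p637250) + the LEAD's «pressure spikes cost enstrophy» (`…SqueezePressureThin{Tools,}`, p639114 / p639126) settle the ORIGIN-CENTRED sharp channel stratum
with the threshold `c₁ > 1/((2+ρ)(1+ρ))` and no pressure clause.  The PAST / SHIFTED stratum (exact self-similarity about `(T, x₀)` for `τ < T₁` only;
skeleton disjunct 4 of `IsPastSelfSimilarClassical`, v59, still at the seat's g0 threshold `3/((2+ρ)(1+2ρ))`) needs the same thinness from what the PAST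
dictionary delivers: profile data only at LARGE scales (`L ≥ 2 − T₁`) and the member's pressure profile only in GROWTH form
(`Past.profile_pressure_growth_of_gaugeD_past`: `∫_{B_L}|P|^{3/2} ≤ C L^{2−2ρ}`; the weighted whole-space form `∫|P|^{3/2}|y|^{2ρ−2} < ∞` of the origin
dictionary does NOT follow — the dyadic sum is log-divergent).  This file supplies the tools; `…SqueezeSobolevGrowth` proves the growth-form thinness and
`…SqueezeSobolevSharpPast` the past member.

* `Loc.exists_unitSmoothStep` — a `C¹` monotone step `ψ : ℝ → [0,1]`, `ψ = 0` on `(−∞,½]`, `ψ = 1` on `[1,∞)`, `‖ψ′‖ ≤ κ` (`ψ(t) = smoothTransition(2t−1)`).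
* `Loc.norm_fderiv_profilePressure_le`, `Loc.lintegral_fderiv_profilePressure_sq_le` — the pressure gradient from CIV (3.3), `∇P = −(1−γ)U − DU[γy+U]`,
  pointwise (any `γ`) and on `B_{5L}` under linear growth: `∫_{B_{5L}}‖∇P‖² ≤ 2(1−γ)²∫_{B_{5L}}‖U‖² + 2((5|γ|+6K₁)L)²∫_{B_{5L}}‖DU‖²`
  (companion of the LEAD's pointwise `Loc.norm_fderiv_pressure_le_of_profile`, which asks `0 ≤ γ ≤ 1`).
* `Loc.volume_absPressureHigh_inter_ball_le_of_growth` — `vol({s ≤ |Q|} ∩ B_R) ≤ C R^{2−2ρ}/s^{3/2}` for `R ≥ L₁` from GROWTH-form data.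
* `Loc.enormSq_growth_of_growth_le`, `Loc.real_growth_of_growth_le` — from large scales to all scales for ANY continuous integrand (the `E3`-valued case is
  `Shifted.growth_of_growth_le`); used for the past profile's GRADIENT.

HONEST LABEL: tools for ONE dynamical sub-stratum (past form) of THE ONE STATEMENT.  WHAT THIS IS NOT: not NS, not E — 19832 is a crux CLASS on the
MODEL lattice (E/NS strata) and stays OPEN; NS regularity is NOT proved. [folklore; ConstantinIgnatovaVicol2026Putative §3.1.1 (3.3)]
-/

noncomputable section

-- flat `Theorems/<Route><Decl>…` files of one crux share the namespace of the crux (tree convention)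
set_option linter.dupNamespace false

open MeasureTheory Set Filter Topology Metric Function InnerProductSpace Module
open scoped RealInnerProductSpace NNReal ENNReal ContDiff

namespace Summit.NavierStokesRegularity.NavierStokesRegularity.Theorems.PowerGaugeEulerLiouville.Loc

open Literature.Analysis Literature.Analysis.FluidPDE

/-! ### A smooth monotone step -/

/-- **A `C¹` monotone step.**  There are `κ ≥ 0` and `ψ : ℝ → [0,1]` of class `C¹` with `ψ = 0` on `(−∞, ½]`, `ψ = 1` on `[1, ∞)` and
`‖ψ′‖ ≤ κ` everywhere (`ψ(t) = smoothTransition(2t − 1)`). [folklore] -/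
theorem exists_unitSmoothStep :
    ∃ κ : ℝ, 0 ≤ κ ∧ ∃ ψ : ℝ → ℝ, ContDiff ℝ 1 ψ ∧ (∀ t, 0 ≤ ψ t) ∧ (∀ t, ψ t ≤ 1) ∧
      (∀ t, t ≤ 1 / 2 → ψ t = 0) ∧ (∀ t, 1 ≤ t → ψ t = 1) ∧ (∀ t, ‖fderiv ℝ ψ t‖ ≤ κ) := by
  set ψ : ℝ → ℝ := fun t => Real.smoothTransition (2 * t - 1) with hψ
  have hlin : ContDiff ℝ 1 (fun t : ℝ => 2 * t - 1) := (contDiff_const.mul contDiff_id).sub contDiff_const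
  have hst : ContDiff ℝ ∞ Real.smoothTransition := Real.smoothTransition.contDiff
  have hψ1 : ContDiff ℝ 1 ψ := (hst.of_le (by exact_mod_cast le_top)).comp hlin
  have hzero : ∀ t, t ≤ 1 / 2 → ψ t = 0 := fun t ht =>
    Real.smoothTransition.zero_of_nonpos (by linarith)
  have hone : ∀ t, 1 ≤ t → ψ t = 1 := fun t ht =>
    Real.smoothTransition.one_of_one_le (by linarith)
  -- the derivative vanishes off `[½, 1]`
  have hdz : ∀ t, t ∉ Icc (1 / 2 : ℝ) 1 → fderiv ℝ ψ t = 0 := by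
    intro t ht
    rw [mem_Icc, not_and_or, not_le, not_le] at ht
    rcases ht with ht | ht
    · have hev : ψ =ᶠ[𝓝 t] fun _ => (0 : ℝ) :=
        (eventually_lt_nhds ht).mono fun s hs => hzero s hs.le
      rw [hev.fderiv_eq, fderiv_const_apply]
    · have hev : ψ =ᶠ[𝓝 t] fun _ => (1 : ℝ) :=
        (eventually_gt_nhds ht).mono fun s hs => hone s hs.le
      rw [hev.fderiv_eq, fderiv_const_apply]
  have hsupp : HasCompactSupport (fderiv ℝ ψ) := HasCompactSupport.intro isCompact_Icc hdz
  have hdc : Continuous (fderiv ℝ ψ) := hψ1.continuous_fderiv one_ne_zero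
  obtain ⟨κ, hκ⟩ := hdc.bounded_above_of_compact_support hsupp
  refine ⟨max κ 0, le_max_right _ _, ψ, hψ1, fun t => Real.smoothTransition.nonneg _,
    fun t => Real.smoothTransition.le_one _, hzero, hone, fun t => (hκ t).trans (le_max_left _ _)⟩

/-! ### The pressure gradient of a classical profile -/

variable {γ : ℝ} {U : EuclideanSpace ℝ (Fin 3) → EuclideanSpace ℝ (Fin 3)} {P : EuclideanSpace ℝ (Fin 3) → ℝ}

/-- **The pressure gradient from CIV (3.3)**: `∇P = −(1−γ)U − DU[γy + U]`, hence `‖∇P(y)‖ ≤ |1−γ|‖U y‖ + ‖DU(y)‖·‖γy + U y‖`.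
[cite: ConstantinIgnatovaVicol2026Putative, §3.1.1 eq. (3.3)] -/
theorem norm_fderiv_profilePressure_le (hprof : IsSelfSimilarEulerProfile γ 0 U P) (y : EuclideanSpace ℝ (Fin 3)) :
    ‖fderiv ℝ P y‖ ≤ |1 - γ| * ‖U y‖ + ‖fderiv ℝ U y‖ * ‖γ • y + U y‖ := by
  have h := hprof.profile_eq y
  simp only [sub_zero] at h
  have h' : gradient P y = -((1 - γ) • U y + fderiv ℝ U y (γ • y + U y)) := eq_neg_of_add_eq_zero_right h
  have hn : ‖gradient P y‖ = ‖fderiv ℝ P y‖ := by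
    unfold gradient
    exact LinearIsometryEquiv.norm_map _ _
  rw [← hn, h', norm_neg]
  refine (norm_add_le _ _).trans (add_le_add ?_ ?_)
  · rw [norm_smul, Real.norm_eq_abs]
  · exact ContinuousLinearMap.le_opNorm _ _

/-- **The pressure gradient budget on `B_{5L}` under linear growth.**  For a CIV (3.3) profile `(U, P)` with `‖U y‖ ≤ K₁(1+‖y‖)` and `L ≥ 1`:
`∫_{B_{5L}} ‖∇P‖² ≤ 2(1−γ)² ∫_{B_{5L}}‖U‖² + 2((5|γ| + 6K₁)L)² ∫_{B_{5L}}‖DU‖²`. [cite: ConstantinIgnatovaVicol2026Putative, §3.1.1 eq. (3.3)] -/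
theorem lintegral_fderiv_profilePressure_sq_le (hprof : IsSelfSimilarEulerProfile γ 0 U P)
    {K₁ : ℝ} (hK₁ : ∀ y : EuclideanSpace ℝ (Fin 3), ‖U y‖ ≤ K₁ * (1 + ‖y‖)) {L : ℝ} (hL : 1 ≤ L) :
    ∫⁻ y in ball (0 : EuclideanSpace ℝ (Fin 3)) (5 * L), ‖fderiv ℝ P y‖ₑ ^ 2 ≤
      2 * ENNReal.ofReal ((1 - γ) ^ 2) * (∫⁻ y in ball (0 : EuclideanSpace ℝ (Fin 3)) (5 * L), ‖U y‖ₑ ^ 2) +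
        2 * ENNReal.ofReal (((5 * |γ| + 6 * K₁) * L) ^ 2) *
          ∫⁻ y in ball (0 : EuclideanSpace ℝ (Fin 3)) (5 * L), ‖fderiv ℝ U y‖ₑ ^ 2 := by
  have hK₁0 : 0 ≤ K₁ := by
    have := hK₁ 0; simp at this; exact (norm_nonneg _).trans this
  have hL0 : 0 < L := one_pos.trans_le hL
  set K₂ : ℝ := (5 * |γ| + 6 * K₁) * L with hK₂
  have hK₂0 : 0 ≤ K₂ := by positivity
  -- pointwise on the ball
  have hpt : ∀ y ∈ ball (0 : EuclideanSpace ℝ (Fin 3)) (5 * L), ‖fderiv ℝ P y‖ₑ ^ 2 ≤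
      2 * ENNReal.ofReal ((1 - γ) ^ 2) * ‖U y‖ₑ ^ 2 + 2 * ENNReal.ofReal (K₂ ^ 2) * ‖fderiv ℝ U y‖ₑ ^ 2 := by
    intro y hy
    rw [mem_ball_zero_iff] at hy
    have hUy : ‖U y‖ ≤ 6 * K₁ * L := by
      calc ‖U y‖ ≤ K₁ * (1 + ‖y‖) := hK₁ y
        _ ≤ K₁ * (6 * L) := mul_le_mul_of_nonneg_left (by linarith) hK₁0
        _ = 6 * K₁ * L := by ring
    have hW : ‖γ • y + U y‖ ≤ K₂ := by
      calc ‖γ • y + U y‖ ≤ ‖γ • y‖ + ‖U y‖ := norm_add_le _ _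
        _ ≤ |γ| * (5 * L) + 6 * K₁ * L := by
            rw [norm_smul, Real.norm_eq_abs]
            exact add_le_add (mul_le_mul_of_nonneg_left hy.le (abs_nonneg _)) hUy
        _ = K₂ := by rw [hK₂]; ring
    have h1 : ‖fderiv ℝ P y‖ ≤ |1 - γ| * ‖U y‖ + ‖fderiv ℝ U y‖ * K₂ :=
      (norm_fderiv_profilePressure_le hprof y).trans
        (add_le_add le_rfl (mul_le_mul_of_nonneg_left hW (norm_nonneg _)))
    have hsq : ‖fderiv ℝ P y‖ ^ 2 ≤ 2 * (1 - γ) ^ 2 * ‖U y‖ ^ 2 + 2 * K₂ ^ 2 * ‖fderiv ℝ U y‖ ^ 2 := by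
      have h2 : 0 ≤ |1 - γ| * ‖U y‖ + ‖fderiv ℝ U y‖ * K₂ := by positivity
      calc ‖fderiv ℝ P y‖ ^ 2 ≤ (|1 - γ| * ‖U y‖ + ‖fderiv ℝ U y‖ * K₂) ^ 2 :=
            pow_le_pow_left₀ (norm_nonneg _) h1 2
        _ ≤ 2 * (|1 - γ| * ‖U y‖) ^ 2 + 2 * (‖fderiv ℝ U y‖ * K₂) ^ 2 := by
            nlinarith [sq_nonneg (|1 - γ| * ‖U y‖ - ‖fderiv ℝ U y‖ * K₂)]
        _ = 2 * (1 - γ) ^ 2 * ‖U y‖ ^ 2 + 2 * K₂ ^ 2 * ‖fderiv ℝ U y‖ ^ 2 := by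
            rw [mul_pow, mul_pow, sq_abs]; ring
    have e1 : ‖fderiv ℝ P y‖ₑ ^ 2 = ENNReal.ofReal (‖fderiv ℝ P y‖ ^ 2) := by
      rw [← ofReal_norm, ENNReal.ofReal_pow (norm_nonneg _)]
    have e2 : ‖U y‖ₑ ^ 2 = ENNReal.ofReal (‖U y‖ ^ 2) := by
      rw [← ofReal_norm, ENNReal.ofReal_pow (norm_nonneg _)]
    have e3 : ‖fderiv ℝ U y‖ₑ ^ 2 = ENNReal.ofReal (‖fderiv ℝ U y‖ ^ 2) := by
      rw [← ofReal_norm, ENNReal.ofReal_pow (norm_nonneg _)]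
    rw [e1, e2, e3]
    calc ENNReal.ofReal (‖fderiv ℝ P y‖ ^ 2)
        ≤ ENNReal.ofReal (2 * (1 - γ) ^ 2 * ‖U y‖ ^ 2 + 2 * K₂ ^ 2 * ‖fderiv ℝ U y‖ ^ 2) := ENNReal.ofReal_le_ofReal hsq
      _ = 2 * ENNReal.ofReal ((1 - γ) ^ 2) * ENNReal.ofReal (‖U y‖ ^ 2) +
            2 * ENNReal.ofReal (K₂ ^ 2) * ENNReal.ofReal (‖fderiv ℝ U y‖ ^ 2) := by
          rw [ENNReal.ofReal_add (by positivity) (by positivity), ENNReal.ofReal_mul (by positivity),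
            ENNReal.ofReal_mul (by norm_num), ENNReal.ofReal_mul (by positivity), ENNReal.ofReal_mul (by norm_num),
            ENNReal.ofReal_ofNat]
  have hmeas : Measurable fun y => 2 * ENNReal.ofReal ((1 - γ) ^ 2) * ‖U y‖ₑ ^ 2 :=
    (hprof.contDiff_velocity.continuous.measurable.enorm.pow_const 2).const_mul _
  calc ∫⁻ y in ball (0 : EuclideanSpace ℝ (Fin 3)) (5 * L), ‖fderiv ℝ P y‖ₑ ^ 2
      ≤ ∫⁻ y in ball (0 : EuclideanSpace ℝ (Fin 3)) (5 * L),
          (2 * ENNReal.ofReal ((1 - γ) ^ 2) * ‖U y‖ₑ ^ 2 + 2 * ENNReal.ofReal (K₂ ^ 2) * ‖fderiv ℝ U y‖ₑ ^ 2) :=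
        lintegral_mono_ae ((ae_restrict_iff' measurableSet_ball).2 (Eventually.of_forall hpt))
    _ = 2 * ENNReal.ofReal ((1 - γ) ^ 2) * (∫⁻ y in ball (0 : EuclideanSpace ℝ (Fin 3)) (5 * L), ‖U y‖ₑ ^ 2) +
          2 * ENNReal.ofReal (K₂ ^ 2) * ∫⁻ y in ball (0 : EuclideanSpace ℝ (Fin 3)) (5 * L), ‖fderiv ℝ U y‖ₑ ^ 2 := by
        rw [lintegral_add_left' hmeas.aemeasurable,
          lintegral_const_mul' _ _ (ENNReal.mul_ne_top ENNReal.ofNat_ne_top ENNReal.ofReal_ne_top),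
          lintegral_const_mul' _ _ (ENNReal.mul_ne_top ENNReal.ofNat_ne_top ENNReal.ofReal_ne_top)]

/-! ### Growth-form `D`-Chebyshev on a ball -/

/-- **Chebyshev on a ball from GROWTH-FORM pressure data.**  `∫_{B_R} |Q|^{3/2} ≤ C R^{2−2ρ}` for `R ≥ L₁` and `s > 0` give, for `R ≥ L₁`,
`vol({s ≤ |Q y|} ∩ B_R) ≤ C R^{2−2ρ} / s^{3/2}` — the form in which the PAST dictionary delivers the member's pressure profile
(`Past.profile_pressure_growth_of_gaugeD_past`); the weighted whole-space form `∫|Q|^{3/2}|y|^{2ρ−2} ≤ C` of the origin-centred dictionary implies it, not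
conversely. [folklore] -/
theorem volume_absPressureHigh_inter_ball_le_of_growth {ρ : ℝ} {Q : EuclideanSpace ℝ (Fin 3) → ℝ}
    (hQm : AEStronglyMeasurable Q volume) {C : ℝ≥0} {L₁ : ℝ}
    (hD : ∀ R : ℝ, L₁ ≤ R → ∫⁻ y in ball (0 : EuclideanSpace ℝ (Fin 3)) R, ‖Q y‖ₑ ^ (3 / 2 : ℝ) ≤
      C * ENNReal.ofReal (R ^ (2 - 2 * ρ)))
    {s R : ℝ} (hs : 0 < s) (hRL₁ : L₁ ≤ R) :
    volume ({y : EuclideanSpace ℝ (Fin 3) | s ≤ ‖Q y‖} ∩ ball 0 R) ≤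
      ENNReal.ofReal ((C : ℝ) * R ^ (2 - 2 * ρ) / s ^ (3 / 2 : ℝ)) := by
  -- adapted from `Loc.volume_pressureHigh_inter_shell_le` (…SelfSimilarBernoulliSqueezeSharpPast, ns-ezl-w5 g0)
  set g : EuclideanSpace ℝ (Fin 3) → ℝ≥0∞ :=
    (ball (0 : EuclideanSpace ℝ (Fin 3)) R).indicator fun y => ‖Q y‖ₑ ^ (3 / 2 : ℝ) with hg
  have hgm : AEMeasurable g volume := (hQm.aemeasurable.enorm.pow_const _).indicator measurableSet_ball
  have hgint : ∫⁻ y, g y = ∫⁻ y in ball (0 : EuclideanSpace ℝ (Fin 3)) R, ‖Q y‖ₑ ^ (3 / 2 : ℝ) := by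
    rw [hg, lintegral_indicator measurableSet_ball]
  have hs32 : 0 < s ^ (3 / 2 : ℝ) := Real.rpow_pos_of_pos hs _
  set lam : ℝ≥0∞ := ENNReal.ofReal (s ^ (3 / 2 : ℝ)) with hlam
  have hlam0 : lam ≠ 0 := (ENNReal.ofReal_pos.2 hs32).ne'
  have hS : ∀ y ∈ {y : EuclideanSpace ℝ (Fin 3) | s ≤ ‖Q y‖} ∩ ball 0 R, lam ≤ g y := by
    rintro y ⟨hy, hyB⟩
    have hy' : s ≤ ‖Q y‖ := hy
    rw [hg, indicator_of_mem hyB, hlam, ← ofReal_norm, ENNReal.ofReal_rpow_of_nonneg (norm_nonneg _) (by norm_num)]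
    exact ENNReal.ofReal_le_ofReal (Real.rpow_le_rpow hs.le hy' (by norm_num))
  calc volume ({y : EuclideanSpace ℝ (Fin 3) | s ≤ ‖Q y‖} ∩ ball 0 R)
      ≤ (∫⁻ y, g y) / lam := BernoulliThinness.measure_le_lintegral_div hgm hlam0 ENNReal.ofReal_ne_top hS
    _ ≤ (C * ENNReal.ofReal (R ^ (2 - 2 * ρ))) / lam := by
        rw [hgint]; exact ENNReal.div_le_div_right (hD R hRL₁) _
    _ = ENNReal.ofReal ((C : ℝ) * R ^ (2 - 2 * ρ) / s ^ (3 / 2 : ℝ)) := by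
        rw [hlam, ← ENNReal.ofReal_coe_nnreal, ← ENNReal.ofReal_mul (NNReal.coe_nonneg _),
          ← ENNReal.ofReal_div_of_pos hs32]

/-! ### From large scales to all scales, any continuous integrand -/

/-- **From large scales to all scales** (any normed codomain; the `E3`-valued case is `Shifted.growth_of_growth_le`): a continuous `f` with
`∫_{B_L}‖f‖² ≤ C L^θ` for `L ≥ L₀` (`C < ∞`, `θ ≤ 3`, `L₀ ≥ 1`) satisfies `∫_{B_L}‖f‖² ≤ C′ L^θ` for ALL `L > 0` with some `C′ < ∞` (`f` is bounded on the
closed ball of radius `L₀`, and `L³ ≤ L₀^{3−θ} L^θ` for `L ≤ L₀`).  Used for the past profile GRADIENT, whose `E`-growth the past dictionary delivers only for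
`L ≥ 2 − T₁`. [folklore] -/
theorem enormSq_growth_of_growth_le {F : Type*} [NormedAddCommGroup F] {f : EuclideanSpace ℝ (Fin 3) → F} (hfc : Continuous f)
    {θ : ℝ} (hθ3 : θ ≤ 3) {L₀ : ℝ} (hL₀ : 1 ≤ L₀) {C : ℝ≥0∞} (hC : C ≠ ⊤)
    (hgr : ∀ L : ℝ, L₀ ≤ L → ∫⁻ y in ball (0 : EuclideanSpace ℝ (Fin 3)) L, ‖f y‖ₑ ^ 2 ≤ C * ENNReal.ofReal (L ^ θ)) :
    ∃ C' : ℝ≥0∞, C' ≠ ⊤ ∧ ∀ L : ℝ, 0 < L →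
      ∫⁻ y in ball (0 : EuclideanSpace ℝ (Fin 3)) L, ‖f y‖ₑ ^ 2 ≤ C' * ENNReal.ofReal (L ^ θ) := by
  -- adapted from `Shifted.growth_of_growth_le` (…SelfSimilarPastExtension)
  obtain ⟨M, hM⟩ := (isCompact_closedBall (0 : EuclideanSpace ℝ (Fin 3)) L₀).exists_bound_of_continuousOn
    hfc.continuousOn
  have hL₀0 : 0 < L₀ := by linarith
  set v₁ : ℝ≥0∞ := volume (ball (0 : EuclideanSpace ℝ (Fin 3)) 1) with hv₁
  have hv₁top : v₁ ≠ ⊤ := measure_ball_lt_top.ne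
  set C₂ : ℝ≥0∞ := ENNReal.ofReal (M ^ 2 * L₀ ^ (3 - θ)) * v₁ with hC₂
  refine ⟨C + C₂, ENNReal.add_ne_top.2 ⟨hC, ENNReal.mul_ne_top ENNReal.ofReal_ne_top hv₁top⟩, fun L hL => ?_⟩
  by_cases hLL : L₀ ≤ L
  · exact (hgr L hLL).trans (by gcongr; exact le_self_add)
  · push Not at hLL
    have hpt : ∀ y ∈ ball (0 : EuclideanSpace ℝ (Fin 3)) L, ‖f y‖ₑ ^ 2 ≤ ENNReal.ofReal (M ^ 2) := by
      intro y hy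
      have hy2 : y ∈ closedBall (0 : EuclideanSpace ℝ (Fin 3)) L₀ :=
        mem_closedBall.2 ((mem_ball.1 hy).le.trans hLL.le)
      rw [← ofReal_norm, ← ENNReal.ofReal_pow (norm_nonneg _)]
      exact ENNReal.ofReal_le_ofReal (pow_le_pow_left₀ (norm_nonneg _) (hM y hy2) 2)
    have h1 : ∫⁻ y in ball (0 : EuclideanSpace ℝ (Fin 3)) L, ‖f y‖ₑ ^ 2 ≤
        ENNReal.ofReal (M ^ 2) * volume (ball (0 : EuclideanSpace ℝ (Fin 3)) L) := by
      calc ∫⁻ y in ball (0 : EuclideanSpace ℝ (Fin 3)) L, ‖f y‖ₑ ^ 2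
          ≤ ∫⁻ _ in ball (0 : EuclideanSpace ℝ (Fin 3)) L, ENNReal.ofReal (M ^ 2) :=
            setLIntegral_mono' measurableSet_ball hpt
        _ = ENNReal.ofReal (M ^ 2) * volume (ball (0 : EuclideanSpace ℝ (Fin 3)) L) := setLIntegral_const _ _
    rw [Measure.addHaar_ball_of_pos volume 0 hL, finrank_euclideanSpace_fin] at h1
    have hL3 : L ^ (3 : ℕ) ≤ L₀ ^ (3 - θ) * L ^ θ := by
      rw [← Real.rpow_natCast L 3, show ((3 : ℕ) : ℝ) = (3 - θ) + θ by push_cast; ring, Real.rpow_add hL]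
      exact mul_le_mul_of_nonneg_right (Real.rpow_le_rpow hL.le hLL.le (by linarith)) (Real.rpow_nonneg hL.le _)
    calc ∫⁻ y in ball (0 : EuclideanSpace ℝ (Fin 3)) L, ‖f y‖ₑ ^ 2
        ≤ ENNReal.ofReal (M ^ 2) * (ENNReal.ofReal (L ^ (3 : ℕ)) * v₁) := h1
      _ ≤ ENNReal.ofReal (M ^ 2) * (ENNReal.ofReal (L₀ ^ (3 - θ) * L ^ θ) * v₁) := by gcongr
      _ = C₂ * ENNReal.ofReal (L ^ θ) := by
          rw [hC₂, ENNReal.ofReal_mul (by positivity), ENNReal.ofReal_mul (by positivity)]; ring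
      _ ≤ (C + C₂) * ENNReal.ofReal (L ^ θ) := by gcongr; exact le_add_self

/-- **Real-constant form**: from `∫_{B_L}‖f‖² ≤ C L^θ` (`L ≥ L₀`, `C < ∞`) to `∫_{B_L}‖f‖² ≤ ofReal(c L^θ)` for ALL `L > 0` with a real `c ≥ 0` — the hypothesis
shape of `Loc.volume_fastSet_inter_far_le_sobolev` / `Loc.volume_pressureHigh_inter_shell_le_sobolev_of_growth`. [folklore] -/
theorem real_growth_of_growth_le {F : Type*} [NormedAddCommGroup F] {f : EuclideanSpace ℝ (Fin 3) → F} (hfc : Continuous f)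
    {θ : ℝ} (hθ3 : θ ≤ 3) {L₀ : ℝ} (hL₀ : 1 ≤ L₀) {C : ℝ≥0∞} (hC : C ≠ ⊤)
    (hgr : ∀ L : ℝ, L₀ ≤ L → ∫⁻ y in ball (0 : EuclideanSpace ℝ (Fin 3)) L, ‖f y‖ₑ ^ 2 ≤ C * ENNReal.ofReal (L ^ θ)) :
    ∃ c : ℝ, 0 ≤ c ∧ ∀ L : ℝ, 0 < L →
      ∫⁻ y in ball (0 : EuclideanSpace ℝ (Fin 3)) L, ‖f y‖ₑ ^ 2 ≤ ENNReal.ofReal (c * L ^ θ) := by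
  obtain ⟨C', hC', hall⟩ := enormSq_growth_of_growth_le hfc hθ3 hL₀ hC hgr
  refine ⟨C'.toReal, ENNReal.toReal_nonneg, fun L hL => (hall L hL).trans (le_of_eq ?_)⟩
  rw [ENNReal.ofReal_mul ENNReal.toReal_nonneg, ENNReal.ofReal_toReal hC']

end Summit.NavierStokesRegularity.NavierStokesRegularity.Theorems.PowerGaugeEulerLiouville.Loc

end
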